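import Summits.HubbardSuperconductivity.HubbardSuperconductivity.Theorems.DeformationLadderApproximatingHamiltonianGCAssembly
import Summits.HubbardSuperconductivity.HubbardSuperconductivity.Theorems.DeformationLadderApproximatingHamiltonianGCSourcedTorusLimit

/-!
# Route `DeformationLadder`, item `ApproximatingHamiltonianGC` (stmt-HubbardSuperconductivity-1895): the theorem

`approximatingHamiltonianGC_proof : ApproximatingHamiltonianGC` — the zero-temperature grand-canonical
approximating-Hamiltonian (Bogoliubov Jr. / Bru–Pedra) formula on the tori `(ℤ/(L+1)ℤ)²` for
`hubbardTorusWith 2 (L+1) 1 U μ − (g/(L+1)²)Δ_dᴴΔ_d`, for every `U ≥ 0`, `μ`, `g > 0`: the `d`-wave source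
energy densities `e(h) = lim E₀(dWaveSourceTorus (L+1) U μ h)/(L+1)²` exist
(`dlst_source_energyDensity_limit`, Ruelle's sub-additivity for lattice fermions with a pair source,
files `…Sourced*.lean`) and `lim E₀(deformed)/(L+1)² = ⨅_{h ≥ 0} (e(h) + h²/g)`
(`approximatingHamiltonianGC_of_sourceLimit`: the tree's finite-volume `T = 0` Bogoliubov Jr. bound
`stub_t0AHM`, an `L`-uniform Lipschitz bound in `h`, coercivity and uniform convergence on compacts).
Sources: Bogolyubov Jr. (1966); Bru–de Siqueira Pedra, Mem. AMS 224 (2013), Thm 107; Ruelle (1969) §2.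
No definitions are introduced.
-/

set_option linter.dupNamespace false

namespace Summit.HubbardSuperconductivity.HubbardSuperconductivity.Theorems

/-- **The zero-temperature grand-canonical approximating-Hamiltonian formula on the tori** (item
stmt-HubbardSuperconductivity-1895 of route `DeformationLadder`, decl `ApproximatingHamiltonianGC`): for
every `U ≥ 0`, `μ ∈ ℝ`, `g > 0` the `d`-wave source energy densities
`e(h) = lim_L E₀(dWaveSourceTorus (L+1) U μ h)/(L+1)²` exist for `h ≥ 0` (indeed for all real `h`), and
`E₀(hubbardTorusWith 2 (L+1) 1 U μ − (g/(L+1)²)·Δ_dᴴΔ_d)/(L+1)² → ⨅_{h ≥ 0} (e(h) + h²/g)`.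
Bogolyubov Jr. (1966); Bru–de Siqueira Pedra (2013), Thm 107; Ruelle (1969) §2. -/
theorem approximatingHamiltonianGC_proof :
    Summit.HubbardSuperconductivity.HubbardSuperconductivity.Theses.DeformationLadder.ApproximatingHamiltonianGC :=
  approximatingHamiltonianGC_of_sourceLimit fun U μ h _ => dlst_source_energyDensity_limit U μ h

end Summit.HubbardSuperconductivity.HubbardSuperconductivity.Theorems
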